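/-
search for candidate a priori estimates; no regularity claim

# K83a — THE JET ALGEBRA OF A POINTWISE DIRECTOR: the pure algebra behind the director-free
# THEOREM R (i)–(ii) (R29; K83b jets, K83c application)

Node of record (verbatim, unchanged): L-λ(q) =
`Summit.NavierStokesRegularity.FunctionalMining.TopEigHeatCoercivePos q := ∃ c > 0,`
`TopEigHeatCoercive q c` — OPEN for every real `q > 1`; (F2) killing family WANTED/OPEN. This
file decides NOTHING about the node: it is the pure-algebra TOOLKIT of (R29) "THEOREM R without
orientation" (K83b `NoGo.TopEigHeatProjectorJet`, K83c `NoGo.TopEigHeatProjectorTwist`), kept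
separate so that it builds AT ONCE on built imports (nothing enters but the definition `svForm`).
THE POINT OF (R29). The kernel chain for exact (F2) witnesses reads: exact witness ⇒ iso-top
(#86) ⇒ no simple point (K81b) ⇒ everywhere biaxial `S = m(1 − 3P)` with a smooth rank-one
PROJECTOR field `P` (K79/K82) ⇒ [(G2): a GLOBAL smooth unit director `n` with `P = n⊗n`] ⇒
`BiaxialTwistFree` (THEOREM R (i) twist-free, (ii) `σ₂ = 0`) ⇒ [(G3)] ⇒ `no_kernel_ruling`
(K82). A line field on `T³` need not be orientable, and `BiaxialEikonal.twistFree` integrates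
over the whole torus, so a local lift cannot reuse it: (G2) was a genuine gap of the kernel
chain. (R29) removes it: every quantity in that proof is EVEN in `n`, hence a polynomial in the
2-jet of `P`, and at a point the 2-jet of `P` is parametrised by a POINTWISE director jet.
§ THE JET. Data at a point: a unit vector `u` (`∑ uᵢ² = 1`), vectors `c_k` (`c k i`, the value
of "`∂ₖn`") and `e_{km}` (`e k m i`, the value of "`∂ₖ∂ₘn`") with the unit-field constraints
`u·c_k = 0` (`huc`), `u·e_{km} = −c_k·c_m` (`hue`), `e_{km} = e_{mk}` (`hes`) — exactly
`unit_first`/`unit_second` of `BiaxialAxisCalculus` read at one point. The induced jets of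
`P = n⊗n` are `B_{k,ab} = c_{k,a}u_b + u_ac_{k,b}` and `H_{km,ab} = e_{km,a}u_b + u_ae_{km,b} +
c_{k,a}c_{m,b} + c_{m,a}c_{k,b}`. With `a_l = ∑ₖ c_{k,l}uₖ`, `θ = ∑ₖ c_{k,k}`, `|c|² = ∑ c_{k,l}²`,
`tr = ∑ c_{k,l}c_{l,k}`: (A1) `∑ₗ H_{km,ll} = 0`; (A2)–(A4) the contractions `T1, T2, T3` of
`BiaxialAxisCalculus` on the jet; (A5) `jet_svForm`: if `∂ₐ∂_bQᵢⱼ(x) = H_{ab,ij}` then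
`J(Q; u)(x) = 2(|c|² − |a|²) − tr − θ²` (`svForm_axis` on a jet); (A6) `jet_nullLagrangian`:
`∑ₖⱼₗ (B_{k,kl}B_{j,jl} + uₖuₗH_{kj,jl} − B_{k,jl}B_{j,kl} − uⱼuₗH_{kj,kl}) = θ² − tr` — the
pointwise algebra of `div((div n)n − (n·∇)n) = (div n)² − tr((∇n)²)` on a jet (the four terms:
`θ² + |a|²`, `E − |a|²`, `tr + |a|²`, `E − |a|²` with `E = ∑ₖⱼ uₖe_{kj,j}`).
HONEST PLACEMENT: finite-sum algebra over a `Fintype` (`Finset.sum_comm`, `Finset.sum_mul_sum`,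
`ring`). [ours; bookkeeping] No number of record moves. NOT CLAIMED: anything about the node.
FILING (prove seat g34, REQUEST #114, carrier restage v2 e36c593b43ca51b2): declarations byte-identical to the no-go seat's staged `TopEigHeatJetAlgebra.STAGING.lean` 4518e2bd73465e10; the only additions are this line and ONE module-docstring line `/-! … -/` (with one blank line) after the imports, required by the gate lint `lint.import`.
-/
import Summits.NavierStokesRegularity.FunctionalMining.BiaxialSaintVenant
import HarnessLib

/-! # K83a — the jet algebra of a pointwise director (module docstring; see the header) -/

noncomputable section

namespace Summit.NavierStokesRegularity.FunctionalMining

open BiaxialEikonal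

namespace TopEig.JetAlg

variable {d : Type*} [Fintype d] [DecidableEq d]

omit [DecidableEq d] in
/-- Bilinear contraction: `∑ᵢⱼ uᵢuⱼ fᵢgⱼ = (∑ uᵢfᵢ)(∑ uⱼgⱼ)`. [folklore; bookkeeping] -/
theorem sum_sum_mul_mul (u f g : d → ℝ) :
    ∑ i, ∑ j, u i * u j * (f i * g j) = (∑ i, u i * f i) * ∑ j, u j * g j := by
  rw [Finset.sum_mul_sum]
  exact Finset.sum_congr rfl fun i _ => Finset.sum_congr rfl fun j _ => by ring

omit [DecidableEq d] in
/-- `∑ᵢⱼ (uᵢfⱼ)(uⱼgᵢ) = (∑ uᵢgᵢ)(∑ uⱼfⱼ)`. [folklore; bookkeeping] -/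
theorem sum_sum_mul_mul' (u f g : d → ℝ) :
    ∑ i, ∑ j, (u i * f j) * (u j * g i) = (∑ i, u i * g i) * ∑ j, u j * f j := by
  rw [Finset.sum_mul_sum]
  exact Finset.sum_congr rfl fun i _ => Finset.sum_congr rfl fun j _ => by ring

omit [DecidableEq d] in
/-- `∑ᵢ∑ₖ uᵢuₖ ∑ⱼ cᵢⱼcₖⱼ = ∑ⱼ (∑ₖ cₖⱼuₖ)²`. [folklore; bookkeeping] -/
theorem sum_sum_mul_mul_sum (u : d → ℝ) (c : d → d → ℝ) :
    ∑ i, ∑ k, u i * u k * ∑ j, c i j * c k j = ∑ l, (∑ k, c k l * u k) ^ 2 := by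
  calc ∑ i, ∑ k, u i * u k * ∑ j, c i j * c k j
      = ∑ i, ∑ k, ∑ j, (u i * c i j) * (u k * c k j) :=
        Finset.sum_congr rfl fun i _ => Finset.sum_congr rfl fun k _ => by
          rw [Finset.mul_sum]
          exact Finset.sum_congr rfl fun j _ => by ring
    _ = ∑ i, ∑ j, ∑ k, (u i * c i j) * (u k * c k j) :=
        Finset.sum_congr rfl fun i _ => Finset.sum_comm
    _ = ∑ j, ∑ i, ∑ k, (u i * c i j) * (u k * c k j) := Finset.sum_comm
    _ = ∑ j, (∑ k, u k * c k j) * ∑ k, u k * c k j :=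
        Finset.sum_congr rfl fun j _ => by rw [Finset.sum_mul_sum]
    _ = ∑ l, (∑ k, c k l * u k) ^ 2 :=
        Finset.sum_congr rfl fun l _ => by
          rw [sq]
          have : ∑ k, u k * c k l = ∑ k, c k l * u k := Finset.sum_congr rfl fun k _ => mul_comm _ _
          rw [this]

section Jet

variable {u : d → ℝ} {c : d → d → ℝ} {e : d → d → d → ℝ}

omit [DecidableEq d] in
/-- `∑ uᵢuᵢ = 1` from `∑ uᵢ² = 1`. [bookkeeping] -/
theorem sum_mul_self_eq_one (hu1 : ∑ i, u i ^ 2 = 1) : ∑ i, u i * u i = 1 := by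
  rw [← hu1]
  exact Finset.sum_congr rfl fun i _ => by ring

omit [DecidableEq d] in
/-- `∑ₗ uₗ aₗ = 0` for `aₗ = ∑ₖ cₖₗ uₖ` when `u·cₖ = 0` for all `k`. [bookkeeping] -/
theorem sum_mul_accel_eq_zero (huc : ∀ k, ∑ i, u i * c k i = 0) :
    ∑ l, u l * ∑ k, c k l * u k = 0 := by
  calc ∑ l, u l * ∑ k, c k l * u k = ∑ l, ∑ k, u k * (u l * c k l) :=
        Finset.sum_congr rfl fun l _ => by
          rw [Finset.mul_sum]
          exact Finset.sum_congr rfl fun k _ => by ring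
    _ = ∑ k, ∑ l, u k * (u l * c k l) := Finset.sum_comm
    _ = ∑ k, u k * ∑ l, u l * c k l := Finset.sum_congr rfl fun k _ => by rw [Finset.mul_sum]
    _ = 0 := by simp [huc]

omit [DecidableEq d] in
/-- **(A1) the trace of the second jet vanishes**: `∑ₗ H_{km,ll} = 0`. [ours; algebra] -/
theorem jet_trace (hue : ∀ k m, ∑ i, u i * e k m i = -∑ i, c k i * c m i) (k m : d) :
    ∑ l, (e k m l * u l + u l * e k m l + c k l * c m l + c m l * c k l) = 0 := by
  have h : ∀ l, e k m l * u l + u l * e k m l + c k l * c m l + c m l * c k l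
      = 2 * (u l * e k m l) + 2 * (c k l * c m l) := fun l => by ring
  simp only [h, Finset.sum_add_distrib, ← Finset.mul_sum, hue k m]
  ring

omit [DecidableEq d] in
/-- **(A2) the `T1` contraction** `∑ᵢⱼ uᵢuⱼ ∑ₖ H_{ik,jk} = −|a|² + ∑ᵢₖ uᵢ e_{ik,k}`. [ours; algebra]
-/
theorem jet_T1 (hu1 : ∑ i, u i ^ 2 = 1) (huc : ∀ k, ∑ i, u i * c k i = 0)
    (hue : ∀ k m, ∑ i, u i * e k m i = -∑ i, c k i * c m i) :
    ∑ i, ∑ j, u i * u j * ∑ k, (e i k j * u k + u j * e i k k + c i j * c k k + c k j * c i k)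
      = -(∑ l, (∑ k, c k l * u k) ^ 2) + ∑ i, ∑ k, u i * e i k k := by
  have h1 := sum_mul_self_eq_one hu1
  have inner : ∀ i k, ∑ j, u i * u j * (e i k j * u k + u j * e i k k + c i j * c k k + c k j * c i
      k)
      = -(u i * u k * ∑ j, c i j * c k j) + u i * e i k k := by
    intro i k
    have hs : ∀ j, u i * u j * (e i k j * u k + u j * e i k k + c i j * c k k + c k j * c i k)
        = (u i * u k) * (u j * e i k j) + (u i * e i k k) * (u j * u j)
            + (u i * c k k) * (u j * c i j)
          + (u i * c i k) * (u j * c k j) := fun j => by ring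
    simp only [hs, Finset.sum_add_distrib, ← Finset.mul_sum, hue i k, h1, huc i, huc k]
    ring
  calc ∑ i, ∑ j, u i * u j * ∑ k, (e i k j * u k + u j * e i k k + c i j * c k k + c k j * c i k)
      = ∑ i, ∑ k, ∑ j, u i * u j * (e i k j * u k + u j * e i k k + c i j * c k k + c k j * c i k)
          :=
        Finset.sum_congr rfl fun i _ => by simp only [Finset.mul_sum]; exact Finset.sum_comm
    _ = ∑ i, ∑ k, (-(u i * u k * ∑ j, c i j * c k j) + u i * e i k k) := by simp only [inner]
    _ = -(∑ l, (∑ k, c k l * u k) ^ 2) + ∑ i, ∑ k, u i * e i k k := by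
        simp only [Finset.sum_add_distrib, Finset.sum_neg_distrib, sum_sum_mul_mul_sum]

omit [DecidableEq d] in
/-- **(A3) the `T2` contraction** `∑ᵢⱼ uᵢuⱼ ∑ₖ H_{kk,ij} = −2|c|²`. [ours; algebra] -/
theorem jet_T2 (hu1 : ∑ i, u i ^ 2 = 1) (huc : ∀ k, ∑ i, u i * c k i = 0)
    (hue : ∀ k m, ∑ i, u i * e k m i = -∑ i, c k i * c m i) :
    ∑ i, ∑ j, u i * u j * ∑ k, (e k k i * u j + u i * e k k j + c k i * c k j + c k i * c k j)
      = -2 * ∑ l, ∑ k, c k l ^ 2 := by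
  have h1 := sum_mul_self_eq_one hu1
  have hk : ∀ k, ∑ i, ∑ j, u i * u j * (e k k i * u j + u i * e k k j + c k i * c k j + c k i * c k
      j)
      = -2 * ∑ l, c k l ^ 2 := by
    intro k
    have hs : ∀ i j, u i * u j * (e k k i * u j + u i * e k k j + c k i * c k j + c k i * c k j)
        = u i * u j * (e k k i * u j) + u i * u j * (u i * e k k j) + 2 * (u i * u j * (c k i * c k
            j)) :=
      fun i j => by ring
    simp only [hs, Finset.sum_add_distrib, ← Finset.mul_sum]
    rw [sum_sum_mul_mul u (e k k) u, sum_sum_mul_mul u u (e k k), sum_sum_mul_mul u (c k) (c k),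
        h1, huc k]
    have he : ∑ i, u i * e k k i = -∑ i, c k i * c k i := hue k k
    have hsq : ∑ l, c k l ^ 2 = ∑ i, c k i * c k i := Finset.sum_congr rfl fun i _ => by ring
    rw [he, hsq]
    ring
  calc ∑ i, ∑ j, u i * u j * ∑ k, (e k k i * u j + u i * e k k j + c k i * c k j + c k i * c k j)
      = ∑ i, ∑ k, ∑ j, u i * u j * (e k k i * u j + u i * e k k j + c k i * c k j + c k i * c k j)
          :=
        Finset.sum_congr rfl fun i _ => by simp only [Finset.mul_sum]; exact Finset.sum_comm
    _ = ∑ k, ∑ i, ∑ j, u i * u j * (e k k i * u j + u i * e k k j + c k i * c k j + c k i * c k j)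
        :=
        Finset.sum_comm
    _ = ∑ k, -2 * ∑ l, c k l ^ 2 := by simp only [hk]
    _ = -2 * ∑ l, ∑ k, c k l ^ 2 := by rw [← Finset.mul_sum, Finset.sum_comm]

omit [DecidableEq d] in
/-- **(A4) the `T3` contraction** `∑ₖₗ H_{kl,kl} = 2∑ᵢₖ uᵢe_{ik,k} + θ² + tr(c̃²)`. [ours; algebra]
-/
theorem jet_T3 (hes : ∀ k m i, e k m i = e m k i) :
    ∑ k, ∑ l, (e k l k * u l + u k * e k l l + c k k * c l l + c l k * c k l)
      = 2 * (∑ i, ∑ k, u i * e i k k) + (∑ k, c k k) ^ 2 + ∑ l, ∑ k, c k l * c l k := by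
  have hA : ∑ k, ∑ l, e k l k * u l = ∑ i, ∑ k, u i * e i k k := by
    calc ∑ k, ∑ l, e k l k * u l = ∑ k, ∑ l, u l * e l k k :=
          Finset.sum_congr rfl fun k _ => Finset.sum_congr rfl fun l _ => by rw [hes k l k,
              mul_comm]
      _ = ∑ i, ∑ k, u i * e i k k := Finset.sum_comm
  have hC : ∑ k, ∑ l, c k k * c l l = (∑ k, c k k) ^ 2 := by rw [sq, Finset.sum_mul_sum]
  simp only [Finset.sum_add_distrib]
  rw [hA, hC]
  ring

/-- **(A5) the Saint-Venant contraction on a jet**: if the second partials of the entries of `Q` at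
`x` are `∂ₐ∂_b Qᵢⱼ(x) = H_{ab,ij}`, then `J(Q; u)(x) = 2(|c|² − |a|²) − tr(c̃²) − θ²`. [ours;
algebra] -/
theorem jet_svForm (hu1 : ∑ i, u i ^ 2 = 1) (huc : ∀ k, ∑ i, u i * c k i = 0)
    (hue : ∀ k m, ∑ i, u i * e k m i = -∑ i, c k i * c m i) (hes : ∀ k m i, e k m i = e m k i)
    {Q : UnitAddTorus d → Matrix d d ℝ} {x : UnitAddTorus d}
    (hH : ∀ a b i j, dd a b (entryFun Q i j) x = e a b i * u j + u i * e a b j + c a i * c b j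
        + c b i * c a j) :
    svForm Q u x = 2 * ((∑ l, ∑ k, c k l ^ 2) - ∑ l, (∑ k, c k l * u k) ^ 2)
      - (∑ l, ∑ k, c k l * c l k) - (∑ k, c k k) ^ 2 := by
  unfold svForm
  simp only [hH, jet_trace hue, Finset.sum_const_zero, sub_zero, zero_sub, hu1, one_mul]
  have hsplit : ∀ i j, u i * u j * (2 * ∑ k, (e i k j * u k + u j * e i k k + c i j * c k k + c k j
      * c i k)
      - ∑ k, (e k k i * u j + u i * e k k j + c k i * c k j + c k i * c k j))
      = 2 * (u i * u j * ∑ k, (e i k j * u k + u j * e i k k + c i j * c k k + c k j * c i k))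
        - u i * u j * ∑ k, (e k k i * u j + u i * e k k j + c k i * c k j + c k i * c k j) := fun i
            j => by ring
  simp only [hsplit, Finset.sum_sub_distrib, ← Finset.mul_sum]
  rw [jet_T1 hu1 huc hue, jet_T2 hu1 huc hue, jet_T3 hes]
  ring

omit [DecidableEq d] in
/-- (A6, term 1) `∑ₖⱼₗ B_{k,kl} B_{j,jl} = θ² + |a|²`. [ours; algebra] -/
theorem jet_N1 (hu1 : ∑ i, u i ^ 2 = 1) (huc : ∀ k, ∑ i, u i * c k i = 0) :
    ∑ k, ∑ j, ∑ l, (c k k * u l + u k * c k l) * (c j j * u l + u j * c j l)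
      = (∑ k, c k k) ^ 2 + ∑ l, (∑ k, c k l * u k) ^ 2 := by
  have h1 := sum_mul_self_eq_one hu1
  have hua := sum_mul_accel_eq_zero huc
  have hg : ∀ l, ∑ k, (c k k * u l + u k * c k l) = (∑ k, c k k) * u l + ∑ k, c k l * u k := fun l
      => by
    rw [Finset.sum_add_distrib, Finset.sum_mul]
    exact congrArg₂ (· + ·) rfl (Finset.sum_congr rfl fun k _ => mul_comm _ _)
  calc ∑ k, ∑ j, ∑ l, (c k k * u l + u k * c k l) * (c j j * u l + u j * c j l)
      = ∑ k, ∑ l, ∑ j, (c k k * u l + u k * c k l) * (c j j * u l + u j * c j l) :=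
        Finset.sum_congr rfl fun k _ => Finset.sum_comm
    _ = ∑ l, ∑ k, ∑ j, (c k k * u l + u k * c k l) * (c j j * u l + u j * c j l) := Finset.sum_comm
    _ = ∑ l, (∑ k, (c k k * u l + u k * c k l)) * ∑ j, (c j j * u l + u j * c j l) :=
        Finset.sum_congr rfl fun l _ => by rw [Finset.sum_mul_sum]
    _ = ∑ l, ((∑ k, c k k) * u l + ∑ k, c k l * u k) * ((∑ k, c k k) * u l + ∑ k, c k l * u k) := by
        simp only [hg]
    _ = ∑ l, ((∑ k, c k k) ^ 2 * (u l * u l) + 2 * (∑ k, c k k) * (u l * ∑ k, c k l * u k)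
          + (∑ k, c k l * u k) ^ 2) := Finset.sum_congr rfl fun l _ => by ring
    _ = (∑ k, c k k) ^ 2 + ∑ l, (∑ k, c k l * u k) ^ 2 := by
        rw [Finset.sum_add_distrib, Finset.sum_add_distrib, ← Finset.mul_sum, ← Finset.mul_sum, h1,
            hua]
        ring

omit [DecidableEq d] in
/-- (A6, term 3) `∑ₖⱼₗ B_{k,jl} B_{j,kl} = tr(c̃²) + |a|²`. [ours; algebra] -/
theorem jet_N3 (hu1 : ∑ i, u i ^ 2 = 1) (huc : ∀ k, ∑ i, u i * c k i = 0) :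
    ∑ k, ∑ j, ∑ l, (c k j * u l + u j * c k l) * (c j k * u l + u k * c j l)
      = (∑ l, ∑ k, c k l * c l k) + ∑ l, (∑ k, c k l * u k) ^ 2 := by
  have h1 := sum_mul_self_eq_one hu1
  have inner : ∀ k j, ∑ l, (c k j * u l + u j * c k l) * (c j k * u l + u k * c j l)
      = c j k * c k j + (u k * u j) * ∑ l, c k l * c j l := by
    intro k j
    have hs : ∀ l, (c k j * u l + u j * c k l) * (c j k * u l + u k * c j l)
        = (c k j * c j k) * (u l * u l) + (c k j * u k) * (u l * c j l)
            + (u j * c j k) * (u l * c k l)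
          + (u k * u j) * (c k l * c j l) := fun l => by ring
    simp only [hs, Finset.sum_add_distrib, ← Finset.mul_sum, h1, huc j, huc k]
    ring
  simp only [inner, Finset.sum_add_distrib]
  rw [sum_sum_mul_mul_sum u c]

omit [DecidableEq d] in
/-- (A6, term 2) `∑ₖⱼₗ uₖuₗ H_{kj,jl} = ∑ₖⱼ uₖ e_{kj,j} − |a|²`. [ours; algebra] -/
theorem jet_N2 (hu1 : ∑ i, u i ^ 2 = 1) (huc : ∀ k, ∑ i, u i * c k i = 0)
    (hue : ∀ k m, ∑ i, u i * e k m i = -∑ i, c k i * c m i) :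
    ∑ k, ∑ j, ∑ l, u k * u l * (e k j j * u l + u j * e k j l + c k j * c j l + c j j * c k l)
      = (∑ i, ∑ k, u i * e i k k) - ∑ l, (∑ k, c k l * u k) ^ 2 := by
  have h1 := sum_mul_self_eq_one hu1
  have inner : ∀ k j, ∑ l, u k * u l * (e k j j * u l + u j * e k j l + c k j * c j l + c j j * c k
      l)
      = u k * e k j j - u k * u j * ∑ l, c k l * c j l := by
    intro k j
    have hs : ∀ l, u k * u l * (e k j j * u l + u j * e k j l + c k j * c j l + c j j * c k l)
        = (u k * e k j j) * (u l * u l) + (u k * u j) * (u l * e k j l)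
            + (u k * c k j) * (u l * c j l)
          + (u k * c j j) * (u l * c k l) := fun l => by ring
    simp only [hs, Finset.sum_add_distrib, ← Finset.mul_sum, h1, hue k j, huc j, huc k]
    ring
  simp only [inner, Finset.sum_sub_distrib]
  rw [sum_sum_mul_mul_sum u c]

omit [DecidableEq d] in
/-- (A6, term 4) `∑ₖⱼₗ uⱼuₗ H_{kj,kl} = ∑ₖⱼ uₖ e_{kj,j} − |a|²` (uses `e_{kj} = e_{jk}`). [ours;
algebra] -/
theorem jet_N4 (hu1 : ∑ i, u i ^ 2 = 1) (huc : ∀ k, ∑ i, u i * c k i = 0)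
    (hue : ∀ k m, ∑ i, u i * e k m i = -∑ i, c k i * c m i) (hes : ∀ k m i, e k m i = e m k i) :
    ∑ k, ∑ j, ∑ l, u j * u l * (e k j k * u l + u k * e k j l + c k k * c j l + c j k * c k l)
      = (∑ i, ∑ k, u i * e i k k) - ∑ l, (∑ k, c k l * u k) ^ 2 := by
  have h1 := sum_mul_self_eq_one hu1
  have inner : ∀ k j, ∑ l, u j * u l * (e k j k * u l + u k * e k j l + c k k * c j l + c j k * c k
      l)
      = u j * e j k k - u k * u j * ∑ l, c k l * c j l := by
    intro k j
    have hs : ∀ l, u j * u l * (e k j k * u l + u k * e k j l + c k k * c j l + c j k * c k l)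
        = (u j * e k j k) * (u l * u l) + (u k * u j) * (u l * e k j l)
            + (u j * c k k) * (u l * c j l)
          + (u j * c j k) * (u l * c k l) := fun l => by ring
    simp only [hs, Finset.sum_add_distrib, ← Finset.mul_sum, h1, hue k j, huc j, huc k]
    rw [hes k j k]
    ring
  simp only [inner, Finset.sum_sub_distrib]
  rw [sum_sum_mul_mul_sum u c]
  congr 1
  exact Finset.sum_comm

omit [DecidableEq d] in
/-- **(A6) THE NULL-LAGRANGIAN ALGEBRA ON A JET**: with `B_{k,ab} = c_{k,a}u_b + u_ac_{k,b}` and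
`H_{kj,ab} = e_{kj,a}u_b + u_ae_{kj,b} + c_{k,a}c_{j,b} + c_{j,a}c_{k,b}`, `∑ₖⱼₗ (B_{k,kl}B_{j,jl} +
uₖuₗH_{kj,jl} − B_{k,jl}B_{j,kl} − uⱼuₗH_{kj,kl}) = θ² − tr(c̃²)`. [ours; algebra] -/
theorem jet_nullLagrangian (hu1 : ∑ i, u i ^ 2 = 1) (huc : ∀ k, ∑ i, u i * c k i = 0)
    (hue : ∀ k m, ∑ i, u i * e k m i = -∑ i, c k i * c m i) (hes : ∀ k m i, e k m i = e m k i) :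
    ∑ k, ∑ j, ∑ l, ((c k k * u l + u k * c k l) * (c j j * u l + u j * c j l)
        + u k * u l * (e k j j * u l + u j * e k j l + c k j * c j l + c j j * c k l)
        - (c k j * u l + u j * c k l) * (c j k * u l + u k * c j l)
        - u j * u l * (e k j k * u l + u k * e k j l + c k k * c j l + c j k * c k l))
      = (∑ k, c k k) ^ 2 - ∑ l, ∑ k, c k l * c l k := by
  simp only [Finset.sum_sub_distrib, Finset.sum_add_distrib]
  rw [jet_N1 hu1 huc, jet_N2 hu1 huc hue, jet_N3 hu1 huc, jet_N4 hu1 huc hue hes]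
  ring

end Jet

end TopEig.JetAlg

end Summit.NavierStokesRegularity.FunctionalMining

end
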